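import Mathlib
import Summits.PneNP.PneNP.Theorems.CnfIdealGenLengthRankDefectRepresentationsTwoFamilyCutDomination

/-!
# Crux `RankDefectRepresentations` (stmt-PneNP-18923), line `rank-dehn-ladder`: TRIANGULAR witnesses against the 2D max-cut
# decomposition are polynomially bounded (lead g9; memo `Lines/rank-dehn-ladder-g9.md` §1 (T))

The registered stub `stub_doubleMaxCutDecomposition` asks that a matrix `D` coloured by `{0,1}^n × {0,1}^{n'}` all of whose double
bipartition cuts have rank `≤ c` is, up to rank `poly(n,n')·c`, a sum `S_I + S_J` of matrices supported on "first colours agree" /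
"second colours agree".  The standard way to REFUTE such a statement is a TRIANGULAR WITNESS: entries `(x_1,y_1),…,(x_N,y_N)` in the
pattern `Ω₂ = {first colours differ ∧ second colours differ}` with `D(x_m,y_m) ≠ 0`, `(x_m, y_{m'}) ∈ Ω₂` and `D(x_m,y_{m'}) = 0` for
`m < m'` — every completion of `D|_{Ω₂}` then has rank `≥ N` (lower-triangular minor), so `N > poly·c` would refute the stub.
`triangularWitness_le` shows this cannot happen: **`N ≤ 4·n·n'·c`**.  Proof: pick for each `m` a first-family coordinate `t_m` where
the colours of `x_m` and `y_m` differ and a second-family coordinate `t'_m` likewise; by pigeonhole `> c` indices share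
`(t_m, bit, t'_m, bit')` if `N > 4nn'c`; for those indices all rows lie in the half-cubes `{ρ_t = bit} × {θ_{t'} = bit'}` and all columns
in the complementary half-cubes, so they span a lower-triangular nonsingular minor INSIDE one double bipartition cut — rank `> c`,
contradiction.  (A random-bipartition version gives the absolute constant 16; the coordinate version is what the cube colouring makes
cheap to formalise.)  Consequence for the disprover: a counterexample to the stub needs completion-rank rigidity that is not triangular.
HONEST FRAMING: a structural remark about the negative lane's open stub; P ≠ NP is not moved; F-N2 is a FRONTIER formal rung.
-/

set_option linter.dupNamespace false -- `Summit.PneNP.PneNP.…`: summit = sub-problem name (D-0017)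

namespace Summit.PneNP.PneNP.Theorems.CnfIdealGenLengthRankDefectRepresentationsDoubleMaxCutTriangularBound

open Matrix Finset
open Summit.PneNP.PneNP.Theorems.CnfIdealGenLengthRankDefectRepresentationsTwoFamilyCutDomination
  (colourI colourJ maskJ doubleCut)

variable {K : Type} [Field K]

/-- A lower-triangular square matrix over a field with nonzero diagonal has full rank. [folklore] -/
theorem rank_eq_card_of_lowerTriangular {s : ℕ} (T : Matrix (Fin s) (Fin s) K)
    (hupper : ∀ i j : Fin s, i < j → T i j = 0) (hdiag : ∀ i, T i i ≠ 0) : T.rank = s := by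
  have hbt : T.BlockTriangular OrderDual.toDual := by
    intro i j hij
    exact hupper i j (by simpa using hij)
  have hdet : T.det ≠ 0 := by
    rw [Matrix.det_of_lowerTriangular T hbt]
    exact Finset.prod_ne_zero_iff.mpr fun i _ => hdiag i
  have hU : IsUnit T := (Matrix.isUnit_iff_isUnit_det T).mpr (isUnit_iff_ne_zero.mpr hdet)
  simpa using Matrix.rank_of_isUnit T hU

variable {n n' : ℕ} {ι ι' : Type} [Fintype ι] [Fintype ι'] [DecidableEq ι] [DecidableEq ι']

omit [Fintype ι] [DecidableEq ι] [DecidableEq ι'] in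
/-- **Triangular witnesses inside `Ω₂` are polynomially bounded by the double cuts.**  If `x_1..x_N`, `y_1..y_N` satisfy: the first-
and second-family colours of `x_m` and `y_{m'}` differ whenever `m ≤ m'`, `D (x_m) (y_m) ≠ 0`, and `D (x_m) (y_{m'}) = 0` for `m < m'`,
and every double bipartition cut of `D` has rank `≤ c`, then `N ≤ 4 n n' c`. -/
theorem triangularWitness_le (row : ι → Fin n ⊕ Fin n' → Bool) (col : ι' → Fin n ⊕ Fin n' → Bool)
    (D : Matrix ι ι' K) (c : ℕ) (hc : ∀ B B', doubleCut row col B B' D ≤ c)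
    {N : ℕ} (x : Fin N → ι) (y : Fin N → ι')
    (hvisI : ∀ m m', m ≤ m' → colourI (row (x m)) ≠ colourI (col (y m')))
    (hvisJ : ∀ m m', m ≤ m' → colourJ (row (x m)) ≠ colourJ (col (y m')))
    (hdiag : ∀ m, D (x m) (y m) ≠ 0) (hzero : ∀ m m', m < m' → D (x m) (y m') = 0) :
    N ≤ 4 * n * n' * c := by
  classical
  -- witness coordinates for each index
  have exI : ∀ m, ∃ t : Fin n, colourI (row (x m)) t ≠ colourI (col (y m)) t := fun m =>
    Function.ne_iff.mp (hvisI m m le_rfl)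
  have exJ : ∀ m, ∃ t : Fin n', colourJ (row (x m)) t ≠ colourJ (col (y m)) t := fun m =>
    Function.ne_iff.mp (hvisJ m m le_rfl)
  choose tI htI using exI
  choose tJ htJ using exJ
  let key : Fin N → (Fin n × Bool) × (Fin n' × Bool) :=
    fun m => ((tI m, colourI (row (x m)) (tI m)), (tJ m, colourJ (row (x m)) (tJ m)))
  refine le_of_not_gt fun hN => ?_
  -- pigeonhole: some key is shared by more than `c` indices
  have hcard : Fintype.card ((Fin n × Bool) × (Fin n' × Bool)) * c < Fintype.card (Fin N) := by
    simp only [Fintype.card_prod, Fintype.card_fin, Fintype.card_bool]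
    calc n * 2 * (n' * 2) * c = 4 * n * n' * c := by ring
      _ < N := hN
  obtain ⟨k, hk⟩ := Fintype.exists_lt_card_fiber_of_mul_lt_card key hcard
  set F : Finset (Fin N) := Finset.univ.filter (fun m => key m = k) with hF
  -- order the fibre
  set s := F.card with hs
  let e : Fin s ↪o Fin N := F.orderEmbOfFin hs.symm
  have he : ∀ i, e i ∈ F := fun i => F.orderEmbOfFin_mem hs.symm i
  have hkey : ∀ i, key (e i) = k := fun i => (Finset.mem_filter.mp (he i)).2
  have ht : ∀ i, tI (e i) = k.1.1 := fun i => by have h := hkey i; simp only [key] at h; rw [← h]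
  have ha : ∀ i, colourI (row (x (e i))) (tI (e i)) = k.1.2 := fun i => by
    have h := hkey i; simp only [key] at h; rw [← h]
  have ht' : ∀ i, tJ (e i) = k.2.1 := fun i => by have h := hkey i; simp only [key] at h; rw [← h]
  have ha' : ∀ i, colourJ (row (x (e i))) (tJ (e i)) = k.2.2 := fun i => by
    have h := hkey i; simp only [key] at h; rw [← h]
  -- the bipartitions
  set B : Finset (Fin n → Bool) := Finset.univ.filter (fun ρ => ρ k.1.1 = k.1.2) with hB
  set B' : Finset (Fin n' → Bool) := Finset.univ.filter (fun θ => θ k.2.1 = k.2.2) with hB'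
  -- colours of the fibre's rows / columns relative to (B, B')
  have hrowI : ∀ i, colourI (row (x (e i))) ∈ B := by
    intro i
    simp only [hB, Finset.mem_filter, Finset.mem_univ, true_and]
    rw [← ht i, ha i]
  have hcolI : ∀ i, colourI (col (y (e i))) ∉ B := by
    intro i
    simp only [hB, Finset.mem_filter, Finset.mem_univ, true_and]
    rw [← ht i, ← ha i]
    exact fun h' => htI (e i) h'.symm
  have hrowJ : ∀ i, colourJ (row (x (e i))) ∈ B' := by
    intro i
    simp only [hB', Finset.mem_filter, Finset.mem_univ, true_and]
    rw [← ht' i, ha' i]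
  have hcolJ : ∀ i, colourJ (col (y (e i))) ∉ B' := by
    intro i
    simp only [hB', Finset.mem_filter, Finset.mem_univ, true_and]
    rw [← ht' i, ← ha' i]
    exact fun h' => htJ (e i) h'.symm
  -- the first block of the double cut (B, B') contains the fibre's triangular minor
  set Blk : Matrix ι ι' K :=
    Matrix.of fun u v => if colourI (row u) ∈ B ∧ colourI (col v) ∉ B then maskJ row col B' D u v else 0 with hBlk
  set T : Matrix (Fin s) (Fin s) K := fun i j => D (x (e i)) (y (e j)) with hT
  have hTsub : T = Blk.submatrix (fun i => x (e i)) (fun j => y (e j)) := by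
    ext i j
    simp only [hT, hBlk, Matrix.submatrix_apply, Matrix.of_apply, maskJ, hrowI i, hcolI j, hrowJ i, hcolJ j,
      not_false_eq_true, and_self, if_true, ne_eq]
    simp
  have hTrank : T.rank = s := by
    refine rank_eq_card_of_lowerTriangular T (fun i j hij => ?_) (fun i => hdiag (e i))
    exact hzero _ _ (e.strictMono hij)
  have h1 : s ≤ Blk.rank := by
    rw [← hTrank, hTsub]; exact Matrix.rank_submatrix_le _ _ _
  have h2 : Blk.rank ≤ doubleCut row col B B' D := by
    unfold doubleCut; exact Nat.le_add_right _ _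
  have h3 := hc B B'
  have : c < s := hk
  omega

end Summit.PneNP.PneNP.Theorems.CnfIdealGenLengthRankDefectRepresentationsDoubleMaxCutTriangularBound
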